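import Literature.MathematicalPhysics.QuantumFieldTheory.Balaban1983to89.Node00.DressedSlotsOfRecord12
import Literature.MathematicalPhysics.QuantumFieldTheory.Balaban1983to89.Node00.Record12LiveSelector
import Literature.MathematicalPhysics.QuantumFieldTheory.Balaban1983to89.Node00.Record12MeasurabilityAnySelector
import Summits.QuantumFields.YangMills.Theorems.BalabanUVNodesN19MGFFormKernelChainRStep

/-!
# Route `BalabanUVNodes`, node N19 (NE7), lens ROW MF-ID — THE KERNEL DUAL OF NODE 00's SLOT RECURSION AT THE IDENTITY SELECTOR:
# every slot of def-T's start-generic tower `texpAOfRecordFrom … start w (rstepSlotOfRecord … ppSel)` started at a dressing `g·b` of a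
# reference start `b`, two-sidedly comparable to it (`m ≤ g ≤ M`, `0 < m`), IS `toReal ∫⁻ g d(slotMeasure k s V)` for ONE t-free family of
# FINITE measures on the ORIGINAL (level-0) field space — so every class weight `∫ χ_k(s)·slot_k(s)` is an integral of `g` against a finite
# measure (`classMeasureOfSlots`), the MGF form the N19 vacuum-MGF road displays as a hypothesis

Cell `pub-ymgap`, YM-PLAN Track A (HUMAN RULING D-0062), seat `pub-ymgap-dag-n19-d` (g6), lens decomp v5 ROW MF-ID (memo `LENS-decomp.md` v5
§v5.2 pieces MF-T ∕ MF-R ∕ MF-Σ ∕ domination), dag-lead REBALANCE №65 (c) «the AT-RECORD seat» (WORDS-125∕126∕131∕132: generic kernel chain + generic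
MF-R = dag-n19-e `…N19MGFFormKernelChain(RStep)`, CITED here; GUARD⁻ + live selector = dag-n19-c).  Filing `--kind proof --supports stmt-QuantumFields-19912
--as helper` (K3‴ `SpineGivenEndpointR13`; count-neutral).  PART 1 of module A (fixed run `p`, couplings `g`; generic over def-T's start and step weights):
the objects, the identity-selector R-step lemmas, measurability, pointwise finiteness; PART 2 = `…N19MGFKernelTowerMGF` (the representation theorem, the
mass bound, the class weights as MGFs); the consumer `…N19MGFFormAtRecord` instantiates both at F3's dressed slots `Node00.dressedSlotsOfDatum₉` (start
`e^{t·F}·boltzmann`) and at the K0′ witness `θ₀`.  [III] = [Balaban1988Convergent], [IV] = [Balaban1989LargeFieldI].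

DESIGN (three findings, all bookkeeping).
(i) def-T's T-step `tstepOfRecord` ((†), `TStepOfRecord` :290) reads the ℝ≥0-TRUNCATED Radon–Nikodym derivative `margDensity = rnNN` times a
BOCHNER integral against the conditional kernel `condLaw`; def-R's R-step at the IDENTITY selector (`Record12LiveSelector.rstepOfSel_id_TexpA`)
multiplies a slot by its own `{0,1}`-valued self-ratio `∫⌈t_s ∕ ∫⌈t_s` (b01 `fibreIntegral`, a `toReal ∘ lmarginal ∘ ofReal`).  The dual is
therefore built as MEASURE-valued slot families `X_k → Measure X_0` by def-T's own recursion shape: level 0 = `ofReal(b U) • δ_U`; level k+1 =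
`liveFactor • (margDensity V' • ((condLaw V').withDensity ofReal(w·χ_k)).bind (level k))` (§2), where `liveFactor ∈ {0,1}` is the indicator that
the REFERENCE pre-slot (`g ≡ 1`) has finite mass and is live at `V'` — and the Bochner ∕ lintegral junk conventions MATCH (`toReal ∞ = 0` is
exactly def-T's value at a non-integrable point), so NO integrability hypothesis is needed anywhere (part 2 §4).
(ii) The mass bound `∫⁻ (level k+1) ≤ ∫⁻ (level k) ≤ … ≤ ∫⁻ ofReal b` holds WITHOUT `HaarAC` ∕ `k < p.K`, because `withDensity (rnNN) ≤ map avg`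
(Lebesgue decomposition; §1 `lintegral_margDensity_mul_lintegral_condLaw_le`) — the class measures are FINITE at every level (part 2 §5).
(iii) POSITIVITY OF THE STEP WEIGHTS IS LOAD-BEARING: with a signed `w` the dual is a signed measure and the MGF form (finite MEASURES) is false in
general; `0 ≤ w` is displayed (at the record: `Record9InhabitedSU1.wOfRecord_nonneg` from `0 ≤ ζ`, true of print's (3.2)·(3.3)·(3.16)·(3.20)
factors), next to `w ≤ 1`, joint measurability of `w` and measurability of `χ_k(s)` (NODE 00's (H-U) ∕ (H-ζ) rows, `Record12Measurability`).

HONEST FRAMING — what this is NOT.  [folklore ∕ bookkeeping] kernel duality (Mathlib `Measure.bind`, `withDensity`, `lmarginal`, Radon–Nikodym) on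
NODE 00's typed objects; valid at the IDENTITY selector only (lens v5 M19: at a contentful selector F3's (β)-tower is NOT of MGF form); nothing
of Bałaban's is asserted or instantiated ([III] (2.18) ∕ (3.1) ∕ [IV] (0.3) are cited for the SHAPE of the objects read); NE7 ∕ NE1′ NOT proved;
N19 NOT discharged (0∕1); K3′ NOT claimed; counts UNMOVED.  One finite four-torus programme at fixed `ε` — NOT the continuum limit on ℝ⁴, NOT
infinite volume, NOT OS, NOT a mass gap, NOT the Clay problem.  No `sorry`, no `axiom`, no `instance`, no `notation`.
-/

noncomputable section

namespace Summit.QuantumFields.YangMills.BalabanUVNodes.N19MGFKernelTower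

open MeasureTheory ProbabilityTheory
open scoped ENNReal
open Literature.MathematicalPhysics.QuantumFieldTheory.Balaban1983to89
open Literature.MathematicalPhysics.QuantumFieldTheory.Balaban1983to89.Node00
open T4Continuum T4TermReprCoupling B14.Eq218Concrete
open T4AveragingDisintegration hiding SU
open B15.BasicStep (fibreIntegral)
open Summit.QuantumFields.YangMills.BalabanUVNodes.N19MGFFormKernelChainRStep (rratio_self_eq_ite rstepOfSel_id_TexpA_of_slot_sandwich')

/-! ## §1 [folklore] The disintegration INEQUALITY along an averaging (no absolute continuity needed) -/

section Disintegration

variable {α β : Type*} [MeasurableSpace α] [MeasurableSpace β]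

/-- The truncated Radon–Nikodym density of the coarse marginal never overshoots it: `μ.withDensity (margDensity ν μ avg) ≤ ν.map avg`
(Lebesgue decomposition, Mathlib `Measure.withDensity_rnDeriv_le`; equality is `withDensity_margDensity` under absolute continuity). [folklore] -/
theorem withDensity_margDensity_le (ν : Measure β) (μ : Measure α) {avg : β → α} (havg : Measurable avg) :
    μ.withDensity (fun a => (margDensity ν μ avg a : ℝ≥0∞)) ≤ ν.map avg := by
  rw [← jointLaw_fst ν havg]
  refine (withDensity_mono (ae_of_all _ fun a => ?_)).trans (Measure.withDensity_rnDeriv_le _ _)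
  show (((jointLaw ν avg).fst.rnDeriv μ a).toNNReal : ℝ≥0∞) ≤ (jointLaw ν avg).fst.rnDeriv μ a
  exact ENNReal.coe_toNNReal_le_self

variable [StandardBorelSpace β] [Nonempty β]

/-- **THE DISINTEGRATION INEQUALITY**: for a measurable `f ≥ 0` on the fine space, `∫ h(a)·(∫ f d condLaw(a)) dμ(a) ≤ ∫ f dν` — the kernel
transport of def-T's T-step never creates mass (equality under absolute continuity of `ν.map avg`, the tree's `integral_graph_eq`). [folklore] -/
theorem lintegral_margDensity_mul_lintegral_condLaw_le (ν : Measure β) [IsFiniteMeasure ν] (μ : Measure α) [SFinite μ] {avg : β → α}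
    (havg : Measurable avg) {f : β → ℝ≥0∞} (hf : Measurable f) :
    ∫⁻ a, (margDensity ν μ avg a : ℝ≥0∞) * ∫⁻ b, f b ∂(condLaw ν avg a) ∂μ ≤ ∫⁻ b, f b ∂ν := by
  have hG : Measurable fun a => ∫⁻ b, f b ∂(condLaw ν avg a) := hf.lintegral_kernel
  calc ∫⁻ a, (margDensity ν μ avg a : ℝ≥0∞) * ∫⁻ b, f b ∂(condLaw ν avg a) ∂μ
      = ∫⁻ a, ∫⁻ b, f b ∂(condLaw ν avg a) ∂(μ.withDensity fun a => (margDensity ν μ avg a : ℝ≥0∞)) := by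
        rw [lintegral_withDensity_eq_lintegral_mul _ measurable_margDensity.coe_nnreal_ennreal hG]
        rfl
    _ ≤ ∫⁻ a, ∫⁻ b, f b ∂(condLaw ν avg a) ∂((jointLaw ν avg).fst) := by
        refine lintegral_mono' ?_ le_rfl
        rw [jointLaw_fst ν havg]
        exact withDensity_margDensity_le ν μ havg
    _ = ∫⁻ z, f z.2 ∂((jointLaw ν avg).fst ⊗ₘ condLaw ν avg) :=
        (Measure.lintegral_compProd (f := fun z : α × β => f z.2) (hf.comp measurable_snd)).symm
    _ = ∫⁻ z, f z.2 ∂(jointLaw ν avg) := by rw [fst_compProd_condLaw]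
    _ = ∫⁻ b, f b ∂ν := by
        rw [jointLaw]
        exact lintegral_map (f := fun z : α × β => f z.2) (hf.comp measurable_snd) (measurable_graphMap havg)

end Disintegration

/-! ## §2 The measure-valued slot recursion (def-T's `Nat.rec` shape; def-R's R-step at the identity selector as a `{0,1}`-factor) -/

section Tower

variable (F : T4Family) (N : ℕ) [NeZero N] (ν : Stage7Numerics) (τ : TowerNumerics)

/-- **THE PRE-𝐑 MEASURE OF LEVEL `k+1`** from a level-`k` measure family `Q`: the dual of def-T's T-step (†) —
`margDensity(V') • ((condLaw V').withDensity (U ↦ ofReal (w(s')(U,V')·χ_k(init s')(U)))).bind (Q (init s'))`.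
[cite: Balaban1988Convergent, (3.1) p.264, (3.24)–(3.25) p.270 (shape of the step read; bookkeeping)] -/
def preSlotMeasure (w : StepWeightsOfRecord F N ν τ.M) (p : B12.RunParams) (g : ℕ → ℝ) (k : ℕ)
    (Q : SeqOfRecord F ν τ.M g p.K k → GaugeField (F.P p.K) k (SU N) → Measure (GaugeField (F.P p.K) 0 (SU N)))
    (s' : SeqOfRecord F ν τ.M g p.K (k + 1)) (V' : GaugeField (F.P p.K) (k + 1) (SU N)) :
    Measure (GaugeField (F.P p.K) 0 (SU N)) :=
  (avgDensity (avOfRecord F N p.K k).avg V' : ℝ≥0∞) •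
    (((avgKernel (avOfRecord F N p.K k).avg V').withDensity
        (fun U => ENNReal.ofReal (w p g k s' U V' * chiSeqOfRecord F N ν τ.M g p.K k s'.init U))).bind (Q s'.init))

/-- The REFERENCE pre-𝐑 slot of a pre-𝐑 measure family: its total mass, as a real (`toReal`; the undressed, `g ≡ 1` reading).
[cite: Balaban1988Convergent, (3.25) p.270 (bookkeeping)] -/
def refPreSlot (p : B12.RunParams) (g : ℕ → ℝ) (k : ℕ)
    (Qpre : SeqOfRecord F ν τ.M g p.K (k + 1) → GaugeField (F.P p.K) (k + 1) (SU N) → Measure (GaugeField (F.P p.K) 0 (SU N))) :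
    TexpASlot F N ν τ.M p g (k + 1) :=
  fun s' V' => (Qpre s' V' Set.univ).toReal

open Classical in
/-- **THE LIVE FACTOR** of level `k+1` at `(s', V')`: `1` if the reference pre-𝐑 measure has finite mass at `V'` AND the reference pre-𝐑 slot is
LIVE at `V'` in K0a's sense (def-R's identity-selector R-step `rstepSlot … id` of it is non-zero there), else `0` — the t-free `{0,1}`-multiplier
the identity-selector R-step is on every comparable slot family. [cite: Balaban1989LargeFieldI, (0.3) p.176 (shape of the step read; bookkeeping)] -/
def liveFactor (p : B12.RunParams) (g : ℕ → ℝ) (k : ℕ)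
    (Qpre : SeqOfRecord F ν τ.M g p.K (k + 1) → GaugeField (F.P p.K) (k + 1) (SU N) → Measure (GaugeField (F.P p.K) 0 (SU N)))
    (s' : SeqOfRecord F ν τ.M g p.K (k + 1)) (V' : GaugeField (F.P p.K) (k + 1) (SU N)) : ℝ≥0∞ :=
  if Qpre s' V' Set.univ < ∞ ∧ rstepSlot F N ν τ p g (k + 1) id (refPreSlot F N ν τ p g k Qpre) s' V' ≠ 0 then 1 else 0

/-- **THE SLOT MEASURES** — the kernel dual of def-T's slot recursion started at the reference start `b` and run with the step weights `w` and
def-R's identity-selector R-step: level 0 = `ofReal (b U) • δ_U` on every length-0 sequence; level k+1 = `liveFactor • preSlotMeasure (level k)`.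
[cite: Balaban1988Convergent, (2.18) p.257, (3.24) p.270; Balaban1989LargeFieldI, (0.3) p.176 (shape of the recursion read; bookkeeping)] -/
def slotMeasure (w : StepWeightsOfRecord F N ν τ.M) (p : B12.RunParams) (g : ℕ → ℝ) (b : GaugeField (F.P p.K) 0 (SU N) → ℝ) :
    (k : ℕ) → SeqOfRecord F ν τ.M g p.K k → GaugeField (F.P p.K) k (SU N) → Measure (GaugeField (F.P p.K) 0 (SU N))
  | 0 => fun _ U => ENNReal.ofReal (b U) • Measure.dirac U
  | k + 1 => fun s' V' =>
      liveFactor F N ν τ p g k (preSlotMeasure F N ν τ w p g k (slotMeasure w p g b k)) s' V' •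
        preSlotMeasure F N ν τ w p g k (slotMeasure w p g b k) s' V'

/-- **THE CLASS MEASURE** of the sequence `s` at level `k`: `∫ χ_k(s)(V) · slotMeasure k s V dV_k` on the ORIGINAL field space (the `ν K τ` of
`DressedMGFForm.MGFForm`; N14's class measure). [cite: Balaban1988Convergent, (2.18) p.257 (bookkeeping)] -/
def classMeasureOfSlots (w : StepWeightsOfRecord F N ν τ.M) (p : B12.RunParams) (g : ℕ → ℝ) (b : GaugeField (F.P p.K) 0 (SU N) → ℝ)
    (k : ℕ) (s : SeqOfRecord F ν τ.M g p.K k) : Measure (GaugeField (F.P p.K) 0 (SU N)) :=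
  ((fieldMeasure (F.P p.K) k (SU N)).withDensity fun V => ENNReal.ofReal (chiSeqOfRecord F N ν τ.M g p.K k s V)).bind
    (slotMeasure F N ν τ w p g b k s)

/-- Level 0 of the slot measures (`rfl`). [cite: Balaban1988Convergent, (2.18) p.257 (bookkeeping)] -/
theorem slotMeasure_zero (w : StepWeightsOfRecord F N ν τ.M) (p : B12.RunParams) (g : ℕ → ℝ) (b : GaugeField (F.P p.K) 0 (SU N) → ℝ)
    (s : SeqOfRecord F ν τ.M g p.K 0) (U : GaugeField (F.P p.K) 0 (SU N)) :
    slotMeasure F N ν τ w p g b 0 s U = ENNReal.ofReal (b U) • Measure.dirac U := rfl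

/-- Level k+1 of the slot measures (`rfl`). [cite: Balaban1989LargeFieldI, (0.3) p.176 (bookkeeping)] -/
theorem slotMeasure_succ (w : StepWeightsOfRecord F N ν τ.M) (p : B12.RunParams) (g : ℕ → ℝ) (b : GaugeField (F.P p.K) 0 (SU N) → ℝ)
    (k : ℕ) (s' : SeqOfRecord F ν τ.M g p.K (k + 1)) (V' : GaugeField (F.P p.K) (k + 1) (SU N)) :
    slotMeasure F N ν τ w p g b (k + 1) s' V' =
      liveFactor F N ν τ p g k (preSlotMeasure F N ν τ w p g k (slotMeasure F N ν τ w p g b k)) s' V' •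
        preSlotMeasure F N ν τ w p g k (slotMeasure F N ν τ w p g b k) s' V' := rfl

variable {F N ν τ}

/-- The live factor is `0` or `1`. [cite: Balaban1989LargeFieldI, (0.3) p.176 (bookkeeping)] -/
theorem liveFactor_le_one (p : B12.RunParams) (g : ℕ → ℝ) (k : ℕ)
    (Qpre : SeqOfRecord F ν τ.M g p.K (k + 1) → GaugeField (F.P p.K) (k + 1) (SU N) → Measure (GaugeField (F.P p.K) 0 (SU N)))
    (s' : SeqOfRecord F ν τ.M g p.K (k + 1)) (V' : GaugeField (F.P p.K) (k + 1) (SU N)) :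
    liveFactor F N ν τ p g k Qpre s' V' ≤ 1 := by
  unfold liveFactor
  split_ifs
  · exact le_rfl
  · exact zero_le_one

/-! ### §2a def-R's identity-selector R-step on two comparable slot families (corollaries of dag-n19-e's generic MF-R, `…KernelChainRStep`) -/

/-- **def-R's identity-selector R-step kills a slot that vanishes at the point**: `f(s)(V) = 0 ⇒ (R_id f)(s)(V) = 0` (the new slot is the
old one times a ratio). [cite: Balaban1989LargeFieldI, (0.3) p.176 (bookkeeping)] -/
theorem rstepSlot_id_eq_zero_of_eq_zero (p : B12.RunParams) (g : ℕ → ℝ) (k : ℕ) (f : TexpASlot F N ν τ.M p g k)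
    (s : SeqOfRecord F ν τ.M g p.K k) (V : GaugeField (F.P p.K) k (SU N)) (h : f s V = 0) :
    rstepSlot F N ν τ p g k id f s V = 0 := by
  unfold rstepSlot rstepOfSel
  dsimp only
  change f s V * _ = 0
  rw [h, zero_mul]

/-- **[generic, def-R's FILE-7 currency, explicit instance binder `iP` (K0a's TS-8 convention)] THE IDENTITY-SELECTOR R-STEP ON A RE-SLOTTED
REPRESENTATION, positive case** — a COROLLARY of dag-n19-e's `…N19MGFFormKernelChainRStep.rstepOfSel_id_TexpA_of_slot_sandwich'` (the `{0,1}`-multiplier form,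
lens v5 §3) in the shape §4's induction consumes: for a (2.18) representation `r` (`χ ≥ 0`) and a second slot family `T` on the same sequences with
`m·r.TexpA ≤ T ≤ M·r.TexpA` (`0 < m`, `0 ≤ M`): where the REFERENCE R-stepped slot `(R_id r)(a′)(V) ≠ 0`, the re-slotted one is `(R_id {r with TexpA := T})(a′)(V)
= T(a′)(V)`. [cite: Balaban1989LargeFieldI, (0.3) p.176 (bookkeeping)] -/
theorem rstepOfSel_id_TexpA_eq_of_ref_ne_zero {P : Params} {j : ℕ} (iP : DecidableEq (PBond P j)) (r : Step.Repr218 P (SU N) j)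
    (T : r.Adm → Density P j (SU N)) (fib : r.Adm → Finset (PBond P j)) {m M : ℝ} (hm : 0 < m) (hM : 0 ≤ M) (hχ0 : ∀ a V, 0 ≤ r.χ a V)
    (hlo : ∀ a V, m * r.TexpA a V ≤ T a V) (hhi : ∀ a V, T a V ≤ M * r.TexpA a V) (a' : r.Adm) (V : GaugeField P j (SU N))
    (hR : (rstepOfSel r id fib).TexpA a' V ≠ 0) :
    (rstepOfSel { r with TexpA := T } id fib).TexpA a' V = T a' V := by
  have e := rstepOfSel_id_TexpA_of_slot_sandwich' iP r T fib hχ0 hm hM hlo hhi a' V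
  rw [rstepOfSel_id_TexpA N iP, rratio_self_eq_ite iP] at hR
  by_cases h : fibreIntegral (fib a') (rterm r a') V = 0
  · rw [if_pos h, mul_zero] at hR
    exact absurd rfl hR
  · rw [e, if_neg h, mul_one]

/-- **[generic, explicit `iP`] … negative case** (same corollary): where the reference R-stepped slot `(R_id r)(a′)(V)` VANISHES although
`r.TexpA(a′)(V) ≠ 0` (its own ratio is `0` there), the re-slotted one vanishes too. [cite: Balaban1989LargeFieldI, (0.3) p.176 (bookkeeping)] -/
theorem rstepOfSel_id_TexpA_eq_zero_of_ref {P : Params} {j : ℕ} (iP : DecidableEq (PBond P j)) (r : Step.Repr218 P (SU N) j)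
    (T : r.Adm → Density P j (SU N)) (fib : r.Adm → Finset (PBond P j)) {m M : ℝ} (hm : 0 < m) (hM : 0 ≤ M) (hχ0 : ∀ a V, 0 ≤ r.χ a V)
    (hlo : ∀ a V, m * r.TexpA a V ≤ T a V) (hhi : ∀ a V, T a V ≤ M * r.TexpA a V) (a' : r.Adm) (V : GaugeField P j (SU N))
    (hR : (rstepOfSel r id fib).TexpA a' V = 0) (hT₀ : r.TexpA a' V ≠ 0) :
    (rstepOfSel { r with TexpA := T } id fib).TexpA a' V = 0 := by
  have e := rstepOfSel_id_TexpA_of_slot_sandwich' iP r T fib hχ0 hm hM hlo hhi a' V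
  rw [rstepOfSel_id_TexpA N iP, rratio_self_eq_ite iP] at hR
  by_cases h : fibreIntegral (fib a') (rterm r a') V = 0
  · rw [e, if_pos h, mul_zero]
  · rw [if_neg h, mul_one] at hR
    exact absurd hR hT₀

/-- **AT def-R's SLICE OF RECORD: the identity-selector R-step of record is the same `{0,1}`-multiplier on two comparable slot families, positive
case** — `m·f₀ ≤ f ≤ M·f₀` slotwise (`0 < m`, `0 ≤ M`), `(R_id f₀)(s)(V) ≠ 0 ⇒ (R_id f)(s)(V) = f(s)(V)` (the generic lemma instantiated by unification
with def-R's instance-free term `rstepSlot`). [cite: Balaban1989LargeFieldI, (0.3) p.176 (bookkeeping)] -/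
theorem rstepSlot_id_eq_self_of_ref_ne_zero (p : B12.RunParams) (g : ℕ → ℝ) (k : ℕ) {f f₀ : TexpASlot F N ν τ.M p g k} {m M : ℝ}
    (hm : 0 < m) (hM : 0 ≤ M) (hlo : ∀ s V, m * f₀ s V ≤ f s V) (hhi : ∀ s V, f s V ≤ M * f₀ s V)
    (s : SeqOfRecord F ν τ.M g p.K k) (V : GaugeField (F.P p.K) k (SU N)) (hR : rstepSlot F N ν τ p g k id f₀ s V ≠ 0) :
    rstepSlot F N ν τ p g k id f s V = f s V := by
  unfold rstepSlot at hR ⊢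
  exact rstepOfSel_id_TexpA_eq_of_ref_ne_zero _ (sliceOfRecord F N ν τ.M p g k f₀) f (fibOfSeq F ν τ p g k) hm hM
    (chiSeqOfRecord_nonneg F N ν τ.M g p.K k) hlo hhi s V hR

/-- **… negative case at the slice of record**: `(R_id f₀)(s)(V) = 0`, `f₀(s)(V) ≠ 0` ⇒ `(R_id f)(s)(V) = 0`.
[cite: Balaban1989LargeFieldI, (0.3) p.176 (bookkeeping)] -/
theorem rstepSlot_id_eq_zero_of_ref (p : B12.RunParams) (g : ℕ → ℝ) (k : ℕ) {f f₀ : TexpASlot F N ν τ.M p g k} {m M : ℝ}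
    (hm : 0 < m) (hM : 0 ≤ M) (hlo : ∀ s V, m * f₀ s V ≤ f s V) (hhi : ∀ s V, f s V ≤ M * f₀ s V)
    (s : SeqOfRecord F ν τ.M g p.K k) (V : GaugeField (F.P p.K) k (SU N)) (hR : rstepSlot F N ν τ p g k id f₀ s V = 0)
    (hf₀ : f₀ s V ≠ 0) : rstepSlot F N ν τ p g k id f s V = 0 := by
  unfold rstepSlot at hR ⊢
  exact rstepOfSel_id_TexpA_eq_zero_of_ref _ (sliceOfRecord F N ν τ.M p g k f₀) f (fibOfSeq F ν τ p g k) hm hM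
    (chiSeqOfRecord_nonneg F N ν τ.M g p.K k) hlo hhi s V hR hf₀

end Tower

/-! ## §3 Measurability and pointwise finiteness of the slot measures -/

section Measurability

variable {F : T4Family} {N : ℕ} [NeZero N] {ν : Stage7Numerics} {τ : TowerNumerics}
variable {w : StepWeightsOfRecord F N ν τ.M} {p : B12.RunParams} {g : ℕ → ℝ}

/-- The `withDensity` integrand `U ↦ ofReal (w(s')(U,V')·χ_k(init s')(U))` of the pre-𝐑 measure is measurable (jointly measurable `w`, measurable `χ_k`).
[cite: Balaban1988Convergent, (3.2)–(3.3) p.265 (bookkeeping)] -/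
theorem measurable_stepDensity {k : ℕ}
    (hwm : ∀ s', Measurable fun z : GaugeField (F.P p.K) (k + 1) (SU N) × GaugeField (F.P p.K) k (SU N) => w p g k s' z.2 z.1)
    (hχm : ∀ s, Measurable (chiSeqOfRecord F N ν τ.M g p.K k s)) (s' : SeqOfRecord F ν τ.M g p.K (k + 1))
    (V' : GaugeField (F.P p.K) (k + 1) (SU N)) :
    Measurable fun U => ENNReal.ofReal (w p g k s' U V' * chiSeqOfRecord F N ν τ.M g p.K k s'.init U) :=
  (((hwm s').comp measurable_prodMk_left).mul (hχm s'.init)).ennreal_ofReal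

/-- **INTEGRATION AGAINST THE PRE-𝐑 MEASURE**: `∫ f d(pre(s')(V')) = h(V') · ∫ ofReal(w·χ_k)(U) · (∫ f d Q(init s')(U)) condLaw(V', dU)`
(`Measure.lintegral_bind` + `withDensity`). [cite: Balaban1988Convergent, (3.1) p.264 (bookkeeping)] -/
theorem lintegral_preSlotMeasure {k : ℕ}
    (hwm : ∀ s', Measurable fun z : GaugeField (F.P p.K) (k + 1) (SU N) × GaugeField (F.P p.K) k (SU N) => w p g k s' z.2 z.1)
    (hχm : ∀ s, Measurable (chiSeqOfRecord F N ν τ.M g p.K k s))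
    {Q : SeqOfRecord F ν τ.M g p.K k → GaugeField (F.P p.K) k (SU N) → Measure (GaugeField (F.P p.K) 0 (SU N))}
    (hQ : ∀ s, Measurable (Q s)) (s' : SeqOfRecord F ν τ.M g p.K (k + 1)) (V' : GaugeField (F.P p.K) (k + 1) (SU N))
    {f : GaugeField (F.P p.K) 0 (SU N) → ℝ≥0∞} (hf : Measurable f) :
    ∫⁻ x, f x ∂(preSlotMeasure F N ν τ w p g k Q s' V') =
      (avgDensity (avOfRecord F N p.K k).avg V' : ℝ≥0∞) *
        ∫⁻ U, ENNReal.ofReal (w p g k s' U V' * chiSeqOfRecord F N ν τ.M g p.K k s'.init U) * ∫⁻ x, f x ∂(Q s'.init U)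
          ∂(avgKernel (avOfRecord F N p.K k).avg V') := by
  have hg : Measurable fun U => ∫⁻ x, f x ∂(Q s'.init U) := (Measure.measurable_lintegral hf).comp (hQ _)
  unfold preSlotMeasure
  rw [lintegral_smul_measure, Measure.lintegral_bind (hQ _).aemeasurable hf.aemeasurable,
    lintegral_withDensity_eq_lintegral_mul _ (measurable_stepDensity hwm hχm s' V') hg, smul_eq_mul]
  rfl

/-- The pre-𝐑 measure of a measurable level-`k` family is measurable in the coarse field (Mathlib `Measurable.lintegral_kernel_prod_right`).
[cite: Balaban1988Convergent, (3.1) p.264 (bookkeeping)] -/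
theorem measurable_preSlotMeasure {k : ℕ}
    (hwm : ∀ s', Measurable fun z : GaugeField (F.P p.K) (k + 1) (SU N) × GaugeField (F.P p.K) k (SU N) => w p g k s' z.2 z.1)
    (hχm : ∀ s, Measurable (chiSeqOfRecord F N ν τ.M g p.K k s))
    {Q : SeqOfRecord F ν τ.M g p.K k → GaugeField (F.P p.K) k (SU N) → Measure (GaugeField (F.P p.K) 0 (SU N))}
    (hQ : ∀ s, Measurable (Q s)) (s' : SeqOfRecord F ν τ.M g p.K (k + 1)) :
    Measurable (preSlotMeasure F N ν τ w p g k Q s') := by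
  refine Measure.measurable_of_measurable_coe _ fun B hB => ?_
  have e : (fun V' => preSlotMeasure F N ν τ w p g k Q s' V' B) = fun V' =>
      (avgDensity (avOfRecord F N p.K k).avg V' : ℝ≥0∞) *
        ∫⁻ U, ENNReal.ofReal (w p g k s' U V' * chiSeqOfRecord F N ν τ.M g p.K k s'.init U) * ∫⁻ x, B.indicator 1 x ∂(Q s'.init U)
          ∂(avgKernel (avOfRecord F N p.K k).avg V') := by
    funext V'
    rw [← lintegral_indicator_one hB]
    exact lintegral_preSlotMeasure hwm hχm hQ s' V' (measurable_one.indicator hB)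
  rw [e]
  refine measurable_margDensity.coe_nnreal_ennreal.mul ?_
  refine Measurable.lintegral_kernel_prod_right ?_
  have h2 : Measurable fun z : GaugeField (F.P p.K) (k + 1) (SU N) × GaugeField (F.P p.K) k (SU N) =>
      ∫⁻ x, B.indicator 1 x ∂(Q s'.init z.2) :=
    ((Measure.measurable_lintegral (measurable_one.indicator hB)).comp (hQ s'.init)).comp measurable_snd
  exact (((hwm s').mul ((hχm s'.init).comp measurable_snd)).ennreal_ofReal).mul h2

/-- The live factor of a measurable pre-𝐑 family is measurable (finite-mass set, and def-R's identity R-step of the reference pre-slot is a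
measurable function — `Record12MeasurabilityAnySelector.measurable_rstepSlot`). [cite: Balaban1989LargeFieldI, (0.3) p.176 (bookkeeping)] -/
theorem measurable_liveFactor {k : ℕ} (hχm : ∀ s, Measurable (chiSeqOfRecord F N ν τ.M g p.K (k + 1) s))
    {Qpre : SeqOfRecord F ν τ.M g p.K (k + 1) → GaugeField (F.P p.K) (k + 1) (SU N) → Measure (GaugeField (F.P p.K) 0 (SU N))}
    (hQ : ∀ s', Measurable (Qpre s')) (s' : SeqOfRecord F ν τ.M g p.K (k + 1)) :
    Measurable (liveFactor F N ν τ p g k Qpre s') := by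
  classical
  have hmass : ∀ s, Measurable fun V' => Qpre s V' Set.univ := fun s => (Measure.measurable_coe MeasurableSet.univ).comp (hQ s)
  have href : ∀ s, Measurable (refPreSlot F N ν τ p g k Qpre s) := fun s => (hmass s).ennreal_toReal
  have hR : Measurable (rstepSlot F N ν τ p g (k + 1) id (refPreSlot F N ν τ p g k Qpre) s') :=
    measurable_rstepSlot F N ν τ id href hχm s'
  unfold liveFactor
  refine Measurable.ite ?_ measurable_const measurable_const
  exact (measurableSet_lt (hmass s') measurable_const).inter (hR (measurableSet_singleton 0).compl)

/-- **THE SLOT MEASURES ARE MEASURABLE** in the field, at every level (induction through §2's two steps). [cite: Balaban1988Convergent, (2.18) p.257 (bookkeeping)] -/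
theorem measurable_slotMeasure
    (hwm : ∀ k s', Measurable fun z : GaugeField (F.P p.K) (k + 1) (SU N) × GaugeField (F.P p.K) k (SU N) => w p g k s' z.2 z.1)
    (hχm : ∀ k s, Measurable (chiSeqOfRecord F N ν τ.M g p.K k s)) {b : GaugeField (F.P p.K) 0 (SU N) → ℝ} (hbm : Measurable b) :
    ∀ (k : ℕ) (s : SeqOfRecord F ν τ.M g p.K k), Measurable (slotMeasure F N ν τ w p g b k s)
  | 0, s => by
      refine Measure.measurable_of_measurable_coe _ fun B hB => ?_
      have e : (fun U => slotMeasure F N ν τ w p g b 0 s U B) = fun U => ENNReal.ofReal (b U) * B.indicator 1 U := by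
        funext U
        rw [slotMeasure_zero, Measure.smul_apply, smul_eq_mul, Measure.dirac_apply' _ hB]
      rw [e]
      exact hbm.ennreal_ofReal.mul (measurable_one.indicator hB)
  | k + 1, s' => by
      have ih : ∀ s, Measurable (slotMeasure F N ν τ w p g b k s) := fun s => measurable_slotMeasure hwm hχm hbm k s
      have hpre := measurable_preSlotMeasure (hwm k) (hχm k) ih
      refine Measure.measurable_of_measurable_coe _ fun B hB => ?_
      have e : (fun V' => slotMeasure F N ν τ w p g b (k + 1) s' V' B) = fun V' =>
          liveFactor F N ν τ p g k (preSlotMeasure F N ν τ w p g k (slotMeasure F N ν τ w p g b k)) s' V' *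
            preSlotMeasure F N ν τ w p g k (slotMeasure F N ν τ w p g b k) s' V' B := by
        funext V'
        rw [slotMeasure_succ, Measure.smul_apply, smul_eq_mul]
      rw [e]
      exact (measurable_liveFactor (hχm (k + 1)) hpre s').mul ((Measure.measurable_coe hB).comp (hpre s'))

/-- **THE SLOT MEASURES HAVE FINITE MASS AT EVERY POINT** (the live factor kills exactly the points of infinite pre-𝐑 mass — def-T's non-integrable
points, where its Bochner value is `0`). [cite: Balaban1988Convergent, (3.1) p.264 (bookkeeping)] -/
theorem slotMeasure_univ_lt_top (b : GaugeField (F.P p.K) 0 (SU N) → ℝ) :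
    ∀ (k : ℕ) (s : SeqOfRecord F ν τ.M g p.K k) (V : GaugeField (F.P p.K) k (SU N)), slotMeasure F N ν τ w p g b k s V Set.univ < ∞
  | 0, s, U => by
      rw [slotMeasure_zero, Measure.smul_apply, smul_eq_mul, Measure.dirac_apply_of_mem (Set.mem_univ _), mul_one]
      exact ENNReal.ofReal_lt_top
  | k + 1, s', V' => by
      rw [slotMeasure_succ, Measure.smul_apply, smul_eq_mul]
      unfold liveFactor
      split_ifs with h
      · rw [one_mul]; exact h.1
      · rw [zero_mul]; exact ENNReal.zero_lt_top

end Measurability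

end Summit.QuantumFields.YangMills.BalabanUVNodes.N19MGFKernelTower

end
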